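import Mathlib
import Summits.Ventures.PercRepro.TriangleCapThreeBelowFourTrianglesA

/-!
# PercRepro — VERTEX DELETION FOR THE CHERRY TABLE: the graph `D − z` and its counts (p3, gen 38; part 112)

`del D z` is `D` induced on the vertices other than `z` (`SimpleGraph.comap` of the subtype embedding).  Its
vertex count is `k − 1` (`card_del`), its degrees are `deg D v − [v ∼ z]` (`deg_del`), its edge count is
`m − deg D z` (`card_edges_del`), it is `K₄⁻`-free when `D` is (`k4mFree_del`), and
`Σ_v d_D(v)² = Σ_{v ≠ z} d_{D−z}(v)² + 2 Σ_{v ∼ z} d_{D−z}(v) + deg D z + (deg D z)²` (`sum_deg_sq_del`).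
These feed the pendant / isolated-vertex reductions of the cell `(9, 15)` (part 113).  Axioms: standard.
-/

namespace PercRepro

namespace TriangleCap

namespace C047

open Finset

variable {V : Type*} [Fintype V] [DecidableEq V]

/-- `D − z`: the induced graph on `{v // v ≠ z}`. -/
def del (D : SimpleGraph V) (z : V) : SimpleGraph {v : V // v ≠ z} :=
  D.comap (Function.Embedding.subtype (fun v => v ≠ z))

omit [Fintype V] [DecidableEq V] in
/-- Adjacency in `D − z`. -/
theorem del_adj (D : SimpleGraph V) (z : V) (a b : {v : V // v ≠ z}) : (del D z).Adj a b ↔ D.Adj a.1 b.1 :=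
  Iff.rfl

/-- Adjacency in `D − z` is decidable. -/
instance decidableRelDel (D : SimpleGraph V) [DecidableRel D.Adj] (z : V) : DecidableRel (del D z).Adj :=
  fun a b => inferInstanceAs (Decidable (D.Adj a.1 b.1))

/-- `|V − z| = k − 1`. -/
theorem card_del (z : V) : Fintype.card {v : V // v ≠ z} + 1 = Fintype.card V := by
  rw [Fintype.card_subtype_compl, Fintype.card_subtype_eq]
  have : 1 ≤ Fintype.card V := Fintype.card_pos_iff.mpr ⟨z⟩
  omega

/-- The degree in `D − z`: `deg D v` minus one when `v ∼ z`. -/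
theorem deg_del (D : SimpleGraph V) [DecidableRel D.Adj] (z : V) (a : {v : V // v ≠ z}) :
    deg (del D z) a + (if D.Adj a.1 z then 1 else 0) = deg D a.1 := by
  unfold deg
  have h1 : (univ.filter (fun w : {v : V // v ≠ z} => (del D z).Adj a w)).card =
      (univ.filter (fun w : V => w ≠ z ∧ D.Adj a.1 w)).card := by
    rw [← Fintype.card_subtype, ← Fintype.card_subtype]
    exact Fintype.card_congr
      { toFun := fun w => ⟨w.1.1, ⟨w.1.2, w.2⟩⟩
        invFun := fun w => ⟨⟨w.1, w.2.1⟩, w.2.2⟩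
        left_inv := fun w => rfl
        right_inv := fun w => rfl }
  rw [h1]
  have h2 : (univ.filter (fun w : V => D.Adj a.1 w)) =
      (univ.filter (fun w : V => w ≠ z ∧ D.Adj a.1 w)) ∪ (univ.filter (fun w : V => w = z ∧ D.Adj a.1 w)) := by
    ext w
    simp only [mem_filter, mem_univ, true_and, mem_union]
    by_cases hw : w = z
    · subst hw; simp
    · simp [hw]
  have h3 : Disjoint (univ.filter (fun w : V => w ≠ z ∧ D.Adj a.1 w))
      (univ.filter (fun w : V => w = z ∧ D.Adj a.1 w)) := by
    rw [disjoint_left]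
    intro w hw1 hw2
    rw [mem_filter] at hw1 hw2
    exact hw1.2.1 hw2.2.1
  rw [h2, card_union_of_disjoint h3]
  congr 1
  symm
  by_cases hz : D.Adj a.1 z
  · simp only [hz, if_true]
    rw [card_eq_one]
    refine ⟨z, ?_⟩
    ext w
    simp only [mem_filter, mem_univ, true_and, mem_singleton]
    constructor
    · rintro ⟨rfl, -⟩; rfl
    · rintro rfl; exact ⟨rfl, hz⟩
  · simp only [hz, if_false]
    rw [card_eq_zero, filter_eq_empty_iff]
    rintro w - ⟨rfl, h⟩
    exact hz h

/-- Sums over `{v // v ≠ z}` are sums over `univ.erase z`. -/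
theorem sum_del (z : V) (f : V → ℕ) : ∑ a : {v : V // v ≠ z}, f a.1 = ∑ v ∈ univ.erase z, f v := by
  rw [Finset.sum_subtype (univ.erase z) (p := fun v => v ≠ z) (fun v => by simp [mem_erase])]

/-- The edge count of `D − z`: `m − deg D z`. -/
theorem card_edges_del (D : SimpleGraph V) [DecidableRel D.Adj] (z : V) :
    (del D z).edgeFinset.card + deg D z = D.edgeFinset.card := by
  have h1 := sum_deg_eq (del D z)
  have h2 := sum_deg_eq D
  have h3 : ∑ a : {v : V // v ≠ z}, deg D a.1 =
      ∑ a : {v : V // v ≠ z}, deg (del D z) a + ∑ a : {v : V // v ≠ z}, (if D.Adj a.1 z then 1 else 0) := by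
    rw [← sum_add_distrib]
    exact sum_congr rfl (fun a _ => (deg_del D z a).symm)
  have h4 : ∑ a : {v : V // v ≠ z}, (if D.Adj a.1 z then 1 else 0) = deg D z := by
    unfold deg
    rw [sum_del z (fun v => if D.Adj v z then 1 else 0), ← sum_filter, card_eq_sum_ones]
    apply sum_congr _ (fun _ _ => rfl)
    ext w
    simp only [mem_filter, mem_erase, mem_univ, true_and, and_true]
    constructor
    · rintro ⟨-, h⟩; exact h.symm
    · intro h; exact ⟨h.ne.symm, h.symm⟩
  have h5 : ∑ v, deg D v = ∑ a : {v : V // v ≠ z}, deg D a.1 + deg D z := by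
    rw [sum_del z (deg D), ← add_sum_erase univ (deg D) (mem_univ z)]
    ring
  omega

omit [Fintype V] [DecidableEq V] in
/-- `D − z` is `K₄⁻`-free when `D` is. -/
theorem k4mFree_del (D : SimpleGraph V) [DecidableRel D.Adj] (hK : K4mFree D) (z : V) : K4mFree (del D z) := by
  intro S hS
  have hmap : (S.map (Function.Embedding.subtype (fun v => v ≠ z))).card = 4 := by rw [card_map, hS]
  have := hK _ hmap
  unfold adjPairs at this ⊢
  have e : ((S ×ˢ S).filter (fun p : {v : V // v ≠ z} × {v : V // v ≠ z} => (del D z).Adj p.1 p.2)).card =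
      (((S.map (Function.Embedding.subtype (fun v => v ≠ z))) ×ˢ
        (S.map (Function.Embedding.subtype (fun v => v ≠ z)))).filter (fun p : V × V => D.Adj p.1 p.2)).card := by
    apply card_bij (fun p _ => (p.1.1, p.2.1))
    · intro p hp
      rw [mem_filter, mem_product] at hp ⊢
      rw [mem_map, mem_map]
      exact ⟨⟨⟨p.1, hp.1.1, rfl⟩, ⟨p.2, hp.1.2, rfl⟩⟩, hp.2⟩
    · intro p _ q _ h
      simp only [Prod.mk.injEq] at h
      exact Prod.ext (Subtype.ext h.1) (Subtype.ext h.2)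
    · intro q hq
      rw [mem_filter, mem_product, mem_map, mem_map] at hq
      obtain ⟨⟨⟨a, ha, hae⟩, ⟨b, hb, hbe⟩⟩, hadj⟩ := hq
      have hae' : a.1 = q.1 := hae
      have hbe' : b.1 = q.2 := hbe
      refine ⟨(a, b), ?_, Prod.ext hae' hbe'⟩
      rw [mem_filter, mem_product]
      refine ⟨⟨ha, hb⟩, ?_⟩
      show D.Adj a.1 b.1
      rw [hae', hbe']
      exact hadj
  rw [e]
  exact this

/-- **THE SQUARE SUM UNDER DELETION:** `Σ_v d_D(v)² = Σ_{v ≠ z} d_{D−z}(v)² + 2 Σ_{v ∼ z} d_{D−z}(v) + d(z) + d(z)²`. -/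
theorem sum_deg_sq_del (D : SimpleGraph V) [DecidableRel D.Adj] (z : V) :
    ∑ v, deg D v * deg D v = ∑ a : {v : V // v ≠ z}, deg (del D z) a * deg (del D z) a +
      2 * ∑ a : {v : V // v ≠ z}, (if D.Adj a.1 z then deg (del D z) a else 0) + deg D z + deg D z * deg D z := by
  have h5 : ∑ v, deg D v * deg D v = ∑ a : {v : V // v ≠ z}, deg D a.1 * deg D a.1 + deg D z * deg D z := by
    rw [sum_del z (fun v => deg D v * deg D v), ← add_sum_erase univ (fun v => deg D v * deg D v) (mem_univ z)]
    ring
  have h4 : ∑ a : {v : V // v ≠ z}, (if D.Adj a.1 z then 1 else 0) = deg D z := by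
    unfold deg
    rw [sum_del z (fun v => if D.Adj v z then 1 else 0), ← sum_filter, card_eq_sum_ones]
    apply sum_congr _ (fun _ _ => rfl)
    ext w
    simp only [mem_filter, mem_erase, mem_univ, true_and, and_true]
    constructor
    · rintro ⟨-, h⟩; exact h.symm
    · intro h; exact ⟨h.ne.symm, h.symm⟩
  have h6 : ∀ a : {v : V // v ≠ z}, deg D a.1 * deg D a.1 = deg (del D z) a * deg (del D z) a +
      2 * (if D.Adj a.1 z then deg (del D z) a else 0) + (if D.Adj a.1 z then 1 else 0) := by
    intro a
    have := deg_del D z a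
    by_cases h : D.Adj a.1 z
    · simp only [h, if_true] at this ⊢
      rw [← this]
      ring
    · simp only [h, if_false] at this ⊢
      rw [← this]
      ring
  rw [h5, sum_congr rfl (fun a _ => h6 a), sum_add_distrib, sum_add_distrib, ← mul_sum, h4]

end C047

end TriangleCap

end PercRepro
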